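import Literature.NumberTheory.QuadraticForms.GlobalSquareTheorem
import HarnessLib

/-!
# Totally positive elements of a number field with prescribed local square classes

Topic `NumberTheory/NumberFields`; namespace `Literature.NumberTheory.NumberFields`.  THEOREMS ONLY (no definition, no
named fact, no instance); Mathlib + the tree's weak approximation / local-squares lemmas.

Let `K` be a number field, `S` a finite set of finite places and `κ_v ∈ K_vˣ` (`v ∈ S`).  Then there is a TOTALLY POSITIVE
`t ∈ Kˣ` (`φ(t) > 0` for every real embedding `φ : K →+* ℝ`) with `t / κ_v ∈ (K_vˣ)²` for every `v ∈ S`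
(`exists_totallyPositive_forall_isSquare_div`; one place: `exists_totallyPositive_isSquare_div`,
`exists_totallyPositive_eq_mul_sq`).  Proof: weak approximation at `S ∪ ∞` (tree
`GaloisRepresentations.denseRange_algebraMap_pi_prod`, [CasselsFrohlichANT1967, Ch. II §6]) for the open set «`v(x − κ_v) < v(4κ_v)`
at `v ∈ S`, `x > 0` at the real places, `x ≠ 0` at the complex ones», and «local squares are open» (tree
`QuadraticForms.isSquare_div_of_valued_sub_lt`, [Omeara1963, §63A Cor. 63:1b]).  This is the elementary input (P5a) of the
re-indexing step of the cell hodgecm-mathlib's road to [Liu2021, Thm. 4.18 (3)] (row III-11): a `p`-adic unit `κ` (a cyclotomic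
value `χ_cyc,p(σ)`) is replaced by a totally positive GLOBAL scalar of the same local square class, so that the rescaled
hermitian line `⟨t·a⟩` is again indexed by a `μ`-admissible element ([Liu2021, Def. 4.12]).  HC_CM is proved only modulo the 7
printed citations until rung 0 closes; this file discharges none of them.

## References
* [CasselsFrohlichANT1967] J. W. S. Cassels, A. Fröhlich (eds.), *Algebraic Number Theory* (1967), Ch. II §6 (weak approximation).
* [Omeara1963] O. T. O'Meara, *Introduction to quadratic forms* (1963), §63A Cor. 63:1b (`F_𝔭²` is open).
* [NeukirchANT1999] J. Neukirch, *Algebraic Number Theory* (1999), Ch. III §1 (infinite primes and embeddings).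
* [Liu2021] Y. Liu, Camb. J. Math. 9 (2021), Def. 4.12; Thm. 4.18 (3) proof l. 2272–2289.
-/

noncomputable section

open NumberField IsDedekindDomain Valued Filter Topology

namespace Literature.NumberTheory.NumberFields

variable {K : Type} [Field K] [NumberField K]

/-! ## §1 Real embeddings versus real places -/

omit [NumberField K] in
/-- A real embedding `φ : K →+* ℝ` is the real embedding of the (real) place of `φ`: `embedding_of_isReal hw = φ` for
`w = mk (φ : K →+* ℂ)` — the real infinite primes of `K` ARE its real embeddings. [cite: NeukirchANT1999, Ch. III §1 (infinite primes = real embeddings and pairs of complex embeddings, p. 184)] -/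
theorem embedding_of_isReal_mk_ofReal_comp (φ : K →+* ℝ) :
    ∃ hw : (InfinitePlace.mk ((algebraMap ℝ ℂ).comp φ)).IsReal,
      InfinitePlace.embedding_of_isReal hw = φ := by
  have hreal : ComplexEmbedding.IsReal ((algebraMap ℝ ℂ).comp φ) := by
    rw [ComplexEmbedding.isReal_iff]
    ext x
    simp [ComplexEmbedding.conjugate_coe_eq]
  refine ⟨InfinitePlace.isReal_mk_iff.2 hreal, RingHom.ext fun x => ?_⟩
  apply Complex.ofReal_injective
  rw [InfinitePlace.embedding_of_isReal_apply, InfinitePlace.embedding_mk_eq_of_isReal hreal]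
  rfl

omit [NumberField K] in
/-- **Positivity at every real place ⇒ total positivity**: if `σ_w(k) > 0` for every real place `w` (`σ_w` its real
embedding) then `φ(k) > 0` for every `φ : K →+* ℝ` (the real primes are the real embeddings).
[cite: NeukirchANT1999, Ch. III §1 (infinite primes = real embeddings and pairs of complex embeddings, p. 184)] -/
theorem forall_embedding_pos_of_forall_isReal_pos {k : K}
    (h : ∀ (w : InfinitePlace K) (hw : w.IsReal), 0 < InfinitePlace.embedding_of_isReal hw k) (φ : K →+* ℝ) :
    0 < φ k := by
  obtain ⟨hw, hφ⟩ := embedding_of_isReal_mk_ofReal_comp φ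
  rw [← hφ]
  exact h _ hw

omit [NumberField K] in
/-- Conversely total positivity gives positivity at every real place.
[cite: NeukirchANT1999, Ch. III §1 (infinite primes = real embeddings and pairs of complex embeddings, p. 184)] -/
theorem forall_isReal_pos_of_forall_embedding_pos {k : K} (h : ∀ φ : K →+* ℝ, 0 < φ k)
    (w : InfinitePlace K) (hw : w.IsReal) : 0 < InfinitePlace.embedding_of_isReal hw k :=
  h _

omit [NumberField K] in
/-- The isomorphism `K_w ≃+* ℝ` at a real place restricted to `K` is the real embedding `σ_w` (Mathlib
`Completion.extensionEmbeddingOfIsReal_coe`, restated for `algebraMap K K_w`; private plumbing). [folklore] -/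
private theorem ringEquivRealOfIsReal_algebraMap' {w : InfinitePlace K} (hw : w.IsReal) (a : K) :
    InfinitePlace.Completion.ringEquivRealOfIsReal hw (algebraMap K w.Completion a) =
      InfinitePlace.embedding_of_isReal hw a := by
  rw [InfinitePlace.Completion.ringEquivRealOfIsReal_apply, InfinitePlace.Completion.algebraMap_apply]
  simp only [InfinitePlace.Completion.extensionEmbeddingOfIsReal_coe, WithAbs.equiv_apply]

/-! ## §2 Totally positive elements in prescribed local square classes -/

/-- **Weak approximation with squares and signs.**  For a finite set `S` of finite places of the number field `K` and units
`κ_v ∈ K_vˣ` (`v ∈ S`) there is `t ∈ Kˣ`, TOTALLY POSITIVE (`φ(t) > 0` for every `φ : K →+* ℝ`), with `t / κ_v` a square in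
`K_v` for every `v ∈ S`: approximate `(κ_v)_v` at `S` within `v(x − κ_v) < v(4κ_v)` (then `x/κ_v ∈ K_v²`, [Omeara1963, 63:1b]) and a
positive vector at the real places, by weak approximation [CasselsFrohlichANT1967, Ch. II §6].
[cite: CasselsFrohlichANT1967, Ch. II §6 Lemma (weak approximation)] [cite: Omeara1963, §63A Cor. 63:1b] -/
theorem exists_totallyPositive_forall_isSquare_div (S : Finset (HeightOneSpectrum (𝓞 K)))
    (κ : ∀ v : HeightOneSpectrum (𝓞 K), (v.adicCompletion K)ˣ) :
    ∃ t : Kˣ, (∀ φ : K →+* ℝ, 0 < φ (t : K)) ∧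
      ∀ v ∈ S, IsSquare (algebraMap K (v.adicCompletion K) (t : K) / (κ v : v.adicCompletion K)) := by
  classical
  -- the neighbourhoods
  let U : ∀ v : (S : Type), Set (v.1.adicCompletion K) :=
    fun v ↦ {x | Valued.v (x - (κ v.1 : v.1.adicCompletion K)) < Valued.v (4 * (κ v.1 : v.1.adicCompletion K))}
  let V : ∀ w : InfinitePlace K, Set w.Completion := fun w ↦
    if hw : w.IsReal then {x | 0 < InfinitePlace.Completion.ringEquivRealOfIsReal hw x} else {x | x ≠ 0}
  have hU : ∀ v : (S : Type), U v ∈ 𝓝 (κ v.1 : v.1.adicCompletion K) := by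
    intro v
    haveI : CharZero (v.1.adicCompletion K) := charZero_of_injective_algebraMap (algebraMap K _).injective
    have h4 : (4 : v.1.adicCompletion K) ≠ 0 := by norm_num
    have hne : Valued.v.restrict (4 * (κ v.1 : v.1.adicCompletion K)) ≠ 0 := by simp [h4, (κ v.1).ne_zero]
    rw [Valued.mem_nhds]
    refine ⟨Units.mk0 _ hne, fun y hy ↦ ?_⟩
    rw [Set.mem_setOf_eq, Units.val_mk0] at hy
    exact Valued.v.restrict_lt_iff.mp hy
  have hV : ∀ w : InfinitePlace K, V w ∈ 𝓝 (1 : w.Completion) := by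
    intro w
    by_cases hw : w.IsReal
    · simp only [V, dif_pos hw]
      have hcont : Continuous (InfinitePlace.Completion.ringEquivRealOfIsReal hw) :=
        (InfinitePlace.Completion.isometryEquivRealOfIsReal hw).continuous
      refine (isOpen_lt continuous_const hcont).mem_nhds ?_
      rw [Set.mem_setOf_eq, map_one]
      exact one_pos
    · simp only [V, dif_neg hw]
      exact isOpen_ne.mem_nhds one_ne_zero
  have hUpi : Set.pi Set.univ U ∈ 𝓝 (fun v : (S : Type) ↦ (κ v.1 : v.1.adicCompletion K)) :=
    set_pi_mem_nhds Set.finite_univ fun v _ ↦ hU v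
  have hVpi : Set.pi Set.univ V ∈ 𝓝 (fun w : InfinitePlace K ↦ (1 : w.Completion)) :=
    set_pi_mem_nhds Set.finite_univ fun w _ ↦ hV w
  have hprod : (Set.pi Set.univ U) ×ˢ (Set.pi Set.univ V) ∈
      𝓝 ((fun v : (S : Type) ↦ (κ v.1 : v.1.adicCompletion K)), (fun w : InfinitePlace K ↦ (1 : w.Completion))) :=
    prod_mem_nhds hUpi hVpi
  -- weak approximation
  obtain ⟨_, ⟨⟨k, rfl⟩, hkU, hkV⟩⟩ :=
    (GaloisRepresentations.denseRange_algebraMap_pi_prod (K := K) S).inter_nhds_nonempty hprod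
  simp only [Set.mem_pi, Set.mem_univ, forall_const] at hkU hkV
  have hkU' : ∀ v : (S : Type),
      Valued.v (algebraMap K (v.1.adicCompletion K) k - (κ v.1 : v.1.adicCompletion K)) <
        Valued.v (4 * (κ v.1 : v.1.adicCompletion K)) := fun v ↦ hkU v
  have hkV' : ∀ w : InfinitePlace K, algebraMap K w.Completion k ∈ V w := fun w ↦ hkV w
  -- positivity at the real places, read on the real embeddings
  have hpos : ∀ (w : InfinitePlace K) (hw : w.IsReal), 0 < InfinitePlace.embedding_of_isReal hw k := by
    intro w hw
    have h := hkV' w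
    simp only [V, dif_pos hw, Set.mem_setOf_eq] at h
    rwa [ringEquivRealOfIsReal_algebraMap'] at h
  -- `k ≠ 0` (look at any infinite place)
  obtain ⟨w₀⟩ : Nonempty (InfinitePlace K) := inferInstance
  have hk0 : k ≠ 0 := by
    rintro rfl
    have h := hkV' w₀
    rw [map_zero] at h
    by_cases hw : w₀.IsReal
    · have h' : (0 : ℝ) < InfinitePlace.Completion.ringEquivRealOfIsReal hw 0 := by
        simpa only [V, dif_pos hw, Set.mem_setOf_eq] using h
      rw [map_zero] at h'
      exact lt_irrefl _ h'
    · have h' : (0 : w₀.Completion) ≠ 0 := by simpa only [V, dif_neg hw, Set.mem_setOf_eq] using h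
      exact h' rfl
  refine ⟨Units.mk0 k hk0, fun φ ↦ ?_, fun v hv ↦ ?_⟩
  · rw [Units.val_mk0]
    exact forall_embedding_pos_of_forall_isReal_pos hpos φ
  · rw [Units.val_mk0]
    exact (QuadraticForms.isSquare_div_of_valued_sub_lt K v (κ v).ne_zero (hkU' ⟨v, hv⟩)).1

/-- **One place.**  For a finite place `v` and `κ ∈ K_vˣ` there is a totally positive `t ∈ Kˣ` with `t / κ ∈ K_v²`.
[cite: CasselsFrohlichANT1967, Ch. II §6 Lemma (weak approximation)] [cite: Omeara1963, §63A Cor. 63:1b] -/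
theorem exists_totallyPositive_isSquare_div (v : HeightOneSpectrum (𝓞 K)) (κ : (v.adicCompletion K)ˣ) :
    ∃ t : Kˣ, (∀ φ : K →+* ℝ, 0 < φ (t : K)) ∧
      IsSquare (algebraMap K (v.adicCompletion K) (t : K) / (κ : v.adicCompletion K)) := by
  classical
  obtain ⟨t, ht, hsq⟩ :=
    exists_totallyPositive_forall_isSquare_div ({v} : Finset (HeightOneSpectrum (𝓞 K)))
      (Function.update (fun w : HeightOneSpectrum (𝓞 K) ↦ (1 : (w.adicCompletion K)ˣ)) v κ)
  refine ⟨t, ht, ?_⟩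
  have h := hsq v (Finset.mem_singleton_self v)
  rwa [Function.update_self] at h

/-- **One place, unit form.**  For a finite place `v` and `κ ∈ K_vˣ` there are a totally positive `t ∈ Kˣ` and `s ∈ K_vˣ` with
`t = κ · s²` in `K_v` — i.e. `t` and `κ` have THE SAME SQUARE CLASS in `K_vˣ / (K_vˣ)²` (hence the same class modulo every
norm group `Nm_{E_w/K_v} E_wˣ ⊇ (K_vˣ)²`). [cite: CasselsFrohlichANT1967, Ch. II §6 Lemma (weak approximation)] [cite: Omeara1963, §63A Cor. 63:1b] -/
theorem exists_totallyPositive_eq_mul_sq (v : HeightOneSpectrum (𝓞 K)) (κ : (v.adicCompletion K)ˣ) :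
    ∃ (t : Kˣ) (s : (v.adicCompletion K)ˣ), (∀ φ : K →+* ℝ, 0 < φ (t : K)) ∧
      algebraMap K (v.adicCompletion K) (t : K) = (κ : v.adicCompletion K) * (s : v.adicCompletion K) ^ 2 := by
  obtain ⟨t, ht, r, hr⟩ := exists_totallyPositive_isSquare_div v κ
  have ht0 : algebraMap K (v.adicCompletion K) (t : K) ≠ 0 := (map_ne_zero _).2 t.ne_zero
  have hr0 : r ≠ 0 := by
    rintro rfl
    rw [mul_zero, div_eq_zero_iff] at hr
    exact hr.elim ht0 (κ.ne_zero)
  refine ⟨t, Units.mk0 r hr0, ht, ?_⟩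
  rw [Units.val_mk0, sq, ← hr, mul_div_cancel₀ _ κ.ne_zero]

/-- **Units version of the square class statement**: `t · κ⁻¹` is a square in the GROUP `K_vˣ`.
[cite: CasselsFrohlichANT1967, Ch. II §6 Lemma (weak approximation)] [cite: Omeara1963, §63A Cor. 63:1b] -/
theorem exists_totallyPositive_isSquare_units_mul_inv (v : HeightOneSpectrum (𝓞 K)) (κ : (v.adicCompletion K)ˣ) :
    ∃ t : Kˣ, (∀ φ : K →+* ℝ, 0 < φ (t : K)) ∧
      IsSquare (Units.map (algebraMap K (v.adicCompletion K) : K →* v.adicCompletion K) t * κ⁻¹) := by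
  obtain ⟨t, s, ht, hts⟩ := exists_totallyPositive_eq_mul_sq v κ
  refine ⟨t, ht, s, Units.ext ?_⟩
  simp only [Units.val_mul, Units.coe_map, MonoidHom.coe_coe, Units.val_inv_eq_inv_val, hts]
  field_simp

/-! ## §3 The dilation orientation (`κ = s² · t`) used by the local Schrödinger/metaplectic rescaling -/

/-- **Square-class representative, dilation orientation**: for a finite place `v` and ANY `κ ∈ K_v` of valuation `1` (e.g. a cyclotomic
unit `χ_cyc(σ)` read in `𝒪_vˣ`) there are a totally positive GLOBAL `t ∈ Kˣ` and a local `s ∈ K_vˣ` with `s · s · t = κ` in `K_v` — the shape in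
which the additive-character rescaling `ψ_v(κ·) = ψ_v(s²t·)` is fed to the dilation of the Schrödinger model (III-11 road P4, B-p14) and to the
line rescaling `⟨a⟩ ↦ ⟨t a⟩`. [cite: CasselsFrohlichANT1967, Ch. II §6 Lemma (weak approximation)] [cite: Omeara1963, §63A Cor. 63:1b] -/
theorem exists_totallyPositive_sq_mul_algebraMap_eq (v : HeightOneSpectrum (𝓞 K)) (κ : v.adicCompletion K)
    (hκ : Valued.v κ = 1) :
    ∃ (t : Kˣ) (s : (v.adicCompletion K)ˣ), (∀ φ : K →+* ℝ, 0 < φ (t : K)) ∧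
      (s : v.adicCompletion K) * s * algebraMap K (v.adicCompletion K) (t : K) = κ := by
  have hκ0 : κ ≠ 0 := fun h => by simp [h] at hκ
  obtain ⟨t, s, ht, hts⟩ := exists_totallyPositive_eq_mul_sq v (Units.mk0 κ hκ0)
  refine ⟨t, s⁻¹, ht, ?_⟩
  rw [Units.val_mk0] at hts
  rw [hts, Units.val_inv_eq_inv_val]
  field_simp

/-- The same without the positivity clause (the form quoted in the III-11 road's seam ruling, 2026-08-28). [cite: Omeara1963, §63A Cor. 63:1b] -/
theorem exists_sq_mul_algebraMap_eq (v : HeightOneSpectrum (𝓞 K)) (κ : v.adicCompletion K) (hκ : Valued.v κ = 1) :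
    ∃ (t : Kˣ) (s : (v.adicCompletion K)ˣ), (s : v.adicCompletion K) * s * algebraMap K (v.adicCompletion K) (t : K) = κ := by
  obtain ⟨t, s, -, h⟩ := exists_totallyPositive_sq_mul_algebraMap_eq v κ hκ
  exact ⟨t, s, h⟩

end Literature.NumberTheory.NumberFields

end
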